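import Mathlib
import HarnessLib
import Literature.MathematicalPhysics.StatisticalMechanics.WeightIntegrationABKM
import Literature.MathematicalPhysics.StatisticalMechanics.WeightDataABKMDominated
import Literature.MathematicalPhysics.StatisticalMechanics.TorusFRDModeDataHolds

/-!
# Theorem 7.1 (w1)–(w7) of [ABKM19] for the weight tower on `(ℤ/L^N)^d`, with `N`-independent
# constants (assembly over the finite-range decomposition `TorusFRD_holds`)

Assembly of the Chapter-7 files into ONE existence statement for the line's weights: from the
finite-range decomposition of `(−Δ)^{-1}` on the torus (`GradientFRD.TorusFRD_holds`, Buchholz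
Thm 2.4 / ABKM19 Thm 6.1, coefficient matrix `A = 1`) and the `N`-independent parameter schedule
(`exists_schedule_core`, `exists_delta0`) we obtain, for every odd `L ≥ 2^{d+3} + 16R`
(constants `μ, δ₁, δ₀` depending on `L`) and every `N ≥ 1`, the weight data
`W = abkmWeightData L N Mord R θ̄ (schedDelta δ₀ δ₁ N) 𝒞` with:

* `Dominated` by `D_k = mulMat((λm_k⁻¹ + (1+θ_k)Σ_{j>k}c_j)⁻¹)`, `θ_k ∈ [θ̄, 2θ̄]` — Lemma 7.5 (i),(v),
  hence (w1), (w2) and well-definedness of the Gaussian steps (`WeightTower`);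
* `Monotone` (Lemma 7.5 (iv) ⇒ (w1)), `Local` (Lemma 7.5 (iii)), `Additive` (Lemma 7.6 (i) ⇒
  (w3), (w4) with "strictly disjoint" = `dist_∞ > L^k` and `dist_∞ ≥ ¾L^{k+1}`),
  `StrongDominated` for every admissible strong-form coefficient `g ≤ δ'/θ_max` (Lemma 7.6 (ii)
  ⇒ (w5), (w6));
* **(w7)**: `∫ w_k^X(φ+ψ) N(0, circulant 𝒞_{k+1})(dψ) ≤ A^{|X|_k} w_{k:k+1}^X(φ)` for
  `k`-polymers, with `A ≥ 1` depending only on `d, M_ord, R, λ, θ̄` and the decomposition;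
* the clauses of the decomposition needed downstream ((o) zero sum/evenness, (i) positivity,
  (ii) `Σ_j 𝒞_j` inverts `−Δ` on zero-sum fields, (iii) finite range, non-negative multipliers),

recorded as the structure `AbkmWeightBounds` and proved in **`exists_abkm_weight_bounds`** for
`d ≥ 3`, `2 ≤ M_ord ≤ R`, `2M_ord ≤ n < ñ`, `0 < θ̄ ≤ ¼`, `λ > 0`, `2θ̄ + λ < 1`.

Everything is proved; no named fact (uses the discharged `TorusFRD_holds`).  NOT here: (w8) as a
separate statement (our `A` is already `L`-independent), (w9)/Lemma 7.8 and the constant `h₀(L)`.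

## References
* S. Adams, S. Buchholz, R. Kotecký, S. Müller, arXiv:1910.13564, Theorem 7.1, Lemmas 7.3–7.7
  [AdamsBuchholzKoteckyMuller2019].
* S. Buchholz, J. Funct. Anal. 275 (2018), Thm 2.4 [Buchholz2016].
-/

noncomputable section

namespace Literature.MathematicalPhysics.StatisticalMechanics.GradientRG

open Finset Matrix Real MeasureTheory ProbabilityTheory WithLp
open scoped MatrixOrder
open Literature.MathematicalPhysics.StatisticalMechanics.GradientFRD
  (iterDiff supNorm mulMat fourierCoeff cExt InShell ShellBoundsV symbR conv ellOp TorusFRD_holds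
    isElliptic_one exists_shell_and_bounds sum_cExt_mul_symbR_eq_one cExt_fourierCoeff_neg
    cExt_fourierCoeff_zero_mode cExt_nonneg IsUnitSymm)
open Literature.MathematicalPhysics.StatisticalMechanics.TorusPolymer
  (thicken Separated IsPolymer numBlocks)

variable {d : ℕ}

/-- **The conclusions of [ABKM19] Theorem 7.1 (w1)–(w7) for the torus weight data** (plus the
clauses of the decomposition used downstream), for `W = abkmWeightData L N Mord R θ̄ δ' 𝒞` with
`δ' = schedDelta δ₀ δ₁ N`. [cite: AdamsBuchholzKoteckyMuller2019, Theorem 7.1] -/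
structure AbkmWeightBounds {M : ℕ} [NeZero M] (L N Mord R n : ℕ) (θbar lam μ δ₁ δ₀ A : ℝ)
    (𝒞 : ℕ → (Fin d → ZMod M) → ℝ) (W : WeightData (Fin d → ZMod M)) : Prop where
  /-- the data -/
  eq : W = abkmWeightData L N Mord R θbar (schedDelta δ₀ δ₁ N) 𝒞
  /-- Lemma 7.5 (i),(v): domination by the multiplier sequence -/
  dominated : W.Dominated fun k => mulMat (domMul lam (thetaSeq θbar μ δ₁ N)
    (fun k => derivMul (L : ℝ) k (diffIndex d Mord)) (tailMul N fun κ j => fourierCoeff (𝒞 j) κ) k)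
  /-- `θ_k ∈ [θ̄, 2θ̄]` ((7.41)) -/
  theta_mem : ∀ k, θbar ≤ thetaSeq θbar μ δ₁ N k ∧ thetaSeq θbar μ δ₁ N k ≤ 2 * θbar
  /-- Lemma 7.5 (iv) -/
  monotone : W.Monotone
  /-- Lemma 7.5 (iii) -/
  isLocal : W.Local fun k X => thicken (nbRad R L k) X
  /-- Lemma 7.6 (i) -/
  additive : W.Additive (fun k X => thicken (nbRad R L k) X)
    (fun k X Y => Separated (sepRadF L k) X Y) fun k X Y => Separated (sepRadM L k) X Y
  /-- Lemma 7.6 (ii), for every admissible strong form -/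
  strong : ∀ s' : Finset (Fin d → ℕ), s' ⊆ diffIndex d Mord → ∀ g : ℕ → ℝ,
    (∀ k, g k ≤ schedDelta δ₀ δ₁ N k / thetaMax R d) →
    W.StrongDominated (fun k X => g k • derivForm (L : ℝ) k s'
      (boxDensity (boxRad R L k) (boxWt (L : ℝ) d k) X)) fun _ X Y => Disjoint X Y
  /-- Theorem 7.1 (w7) with `A_𝒫/2 = A` -/
  integral : ∀ k, k + 1 ≤ N + 1 → ∀ X : Finset (Fin d → ZMod M), IsPolymer (L ^ k) X →
    ∀ φ : (Fin d → ZMod M) → ℝ,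
      ∫ ψ, W.weight k X (φ + ofLp ψ) ∂(multivariateGaussian 0 (Matrix.circulant (𝒞 (k + 1)))) ≤
        A ^ numBlocks (L ^ k) X * W.midWeight k X φ
  /-- (o): zero sums and evenness of the kernels -/
  zero_sum_even : ∀ j ∈ Icc 1 (N + 1), ∑ x, 𝒞 j x = 0 ∧ ∀ x, 𝒞 j (-x) = 𝒞 j x
  /-- (i): positivity on zero-sum fields -/
  pos : ∀ j ∈ Icc 1 (N + 1), ∀ φ : (Fin d → ZMod M) → ℝ, ∑ x, φ x = 0 →
    0 ≤ ∑ x, ∑ y, φ x * 𝒞 j (x - y) * φ y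
  /-- (ii): `Σ_j 𝒞_j` is the Green's function of `−Δ` on zero-sum fields -/
  green : ∀ φ : (Fin d → ZMod M) → ℝ, ∑ x, φ x = 0 →
    ellOp (1 : Matrix (Fin d) (Fin d) ℝ) (conv (fun x => ∑ j ∈ Icc 1 (N + 1), 𝒞 j x) φ) = φ
  /-- (iii): finite range -/
  finiteRange : ∀ j, 1 ≤ j → j ≤ N → ∃ c : ℝ, ∀ x : Fin d → ZMod M,
    ((L : ℝ) ^ j) / 2 ≤ (supNorm x : ℝ) → 𝒞 j x = c
  /-- (iv) at `Ȧ = 0`, `ℓ = 0`: real-space derivative bounds up to order `n` -/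
  regular : ∃ Cα : (Fin d → ℕ) → ℝ, ∀ j, 1 ≤ j → j ≤ N + 1 → ∀ θ' : Fin d → ℕ, ∑ i, θ' i ≤ n →
    ∀ x, |iterDiff θ' (𝒞 j) x| ≤ Cα θ' / (L : ℝ) ^ ((j - 1) * (d - 2 + ∑ i, θ' i))
  /-- the Fourier multipliers are non-negative -/
  multipliers_nonneg : ∀ (j : ℕ) (κ : Fin d → ZMod M), 0 ≤ cExt N (fun j => fourierCoeff (𝒞 j) κ) j

/-- The zero direction is a unit symmetric direction. [cite: Buchholz2016, Thm 2.4] -/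
theorem isUnitSymm_zero : IsUnitSymm (0 : Matrix (Fin d) (Fin d) ℝ) := by
  refine ⟨Matrix.isSymm_zero, fun z => ?_⟩
  simp only [Matrix.zero_apply, mul_zero, zero_mul, Finset.sum_const_zero, abs_zero]
  positivity

/-- `θ_0 = 2θ̄`. [cite: AdamsBuchholzKoteckyMuller2019, Lemma 7.5 (7.41)] -/
theorem thetaSeq_zero (θbar μ δ₁ : ℝ) (N : ℕ) : thetaSeq θbar μ δ₁ N 0 = 2 * θbar := by
  unfold thetaSeq; simp

/-- **[ABKM19] Theorem 7.1 (w1)–(w7) for the weight tower on the torus, with `N`-independent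
constants.** For `d ≥ 3`, orders `2 ≤ M_ord ≤ R`, regularity `2M_ord ≤ n < ñ`, `0 < θ̄ ≤ ¼`,
`λ > 0`, `2θ̄ + λ < 1`: there are kernels `𝒞` (the finite-range decomposition of `(−Δ)⁻¹`) and a
constant `A ≥ 1` such that for every odd `L ≥ 2^{d+3} + 16R` there are `μ ≥ 0`, `δ₁, δ₀ > 0` (the
schedule, depending on `L` only) such that for every `N ≥ 1` the weight data on `(ℤ/L^N)^d`
satisfies `AbkmWeightBounds`. [cite: AdamsBuchholzKoteckyMuller2019, Theorem 7.1] -/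
theorem exists_abkm_weight_bounds (hd : 3 ≤ d) {Mord R : ℕ} (hMord : 2 ≤ Mord) (hMR : Mord ≤ R)
    {n ñ : ℕ} (hn : 2 * Mord ≤ n) (hnñ : n < ñ) {θbar lam : ℝ} (hθ0 : 0 < θbar)
    (hθ1 : θbar ≤ 1 / 4) (hlam : 0 < lam) (hT : 2 * θbar + lam < 1) :
    ∃ (𝒞 : (L N M : ℕ) → ℕ → (Fin d → ZMod M) → ℝ) (A : ℝ), 1 ≤ A ∧
      ∀ L : ℕ, Odd L → 2 ^ (d + 3) + 16 * R ≤ L →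
        ∃ (μ δ₁ δ₀ : ℝ), 0 ≤ μ ∧ 0 < δ₁ ∧ 0 < δ₀ ∧
          ∀ N : ℕ, 1 ≤ N → ∀ (M : ℕ) [NeZero M], M = L ^ N →
            AbkmWeightBounds L N Mord R n θbar lam μ δ₁ δ₀ A (𝒞 L N M)
              (abkmWeightData L N Mord R θbar (schedDelta δ₀ δ₁ N) (𝒞 L N M)) := by
  obtain ⟨𝒞f, Mc, Cα, c, C, Cℓ, hc, hall⟩ :=
    TorusFRD_holds d hd (1 / 2) 2 (by norm_num) (by norm_num) n ñ hnñ
  set s := diffIndex d Mord with hsdef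
  have hsM : ∀ α ∈ s, ∑ i, α i ≤ Mord := fun α hα => (mem_diffIndex.1 hα).2
  have hd1 : 1 ≤ d := by omega
  have hd2 : 2 ≤ d := by omega
  have hMord1 : 1 ≤ Mord := by omega
  have hR2 : 2 ≤ R := hMord.trans hMR
  set A := weightIntConst θbar (traceConst d Mord R lam (derivSum d n fun θ' _ => Cα θ' 0)) with hA
  refine ⟨fun L N M j => 𝒞f L N M 1 j, A, one_le_weightIntConst hθ0
    (traceConst_nonneg d Mord R hlam.le (derivSum_nonneg d n _)), ?_⟩
  intro L hLodd hL
  -- size of `L`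
  have hL64 : 2 ^ 6 ≤ 2 ^ (d + 3) := Nat.pow_le_pow_right (by norm_num) (by omega)
  have hL5 : 5 ≤ L := by omega
  have hL3 : 3 < L := by omega
  have hL1r : (1 : ℝ) < L := by exact_mod_cast (show 1 < L by omega)
  have hLM : Mord ≤ L := by omega
  have h3L : 2 ^ d + 3 * R ≤ 3 * L := by
    have : 2 ^ d ≤ 2 ^ (d + 3) := Nat.pow_le_pow_right (by norm_num) (by omega); omega
  -- the `N`-independent schedule at this `L` (with `ω₀ = 1`, `C ↦ max C 0`)
  have hn' : 2 * (Mord - 1) < d - 1 + n := by omega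
  obtain ⟨k₀, μ, δ₁, hμ0, hδ₁, hμδ, hδlam, hsmall, hlarge⟩ :=
    exists_schedule_core (s := s) hsM hL1r hd1 (ñ := ñ) hn' hlam hc (le_max_right C 0)
      one_pos hθ0
  set K : ℝ := ∑ α ∈ s, ((4 : ℝ) * d) ^ (∑ i, α i - 1) with hK
  obtain ⟨δ₀, hδ₀, hseed⟩ := exists_delta0 (T := 1 + 2 * θbar + lam) (K := K) (by linarith)
    (by linarith) (Finset.sum_nonneg fun _ _ => by positivity)
  refine ⟨μ, δ₁, δ₀, hμ0, hδ₁, hδ₀, ?_⟩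
  intro N hN M _ hM
  obtain ⟨ho, hi, hii, hiii, hiv, hv⟩ := hall L hLodd hL3 N hN M hM 1 isElliptic_one
  -- derived kernel facts
  have ho' : ∀ k ∈ Icc 1 (N + 1), ∑ x : Fin d → ZMod M, 𝒞f L N M 1 k x = 0 ∧
      ∀ x, 𝒞f L N M 1 k (-x) = 𝒞f L N M 1 k x := fun k hk => by
    rw [mem_Icc] at hk; exact ho k hk.1 hk.2
  have hLr0 : (0 : ℝ) ≤ (L : ℝ) := by positivity
  have hv' : ∀ k, 1 ≤ k → k ≤ N + 1 → ∀ j : ℕ, ∀ κ : Fin d → ZMod M, κ ≠ 0 → InShell L j κ →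
      (j < k →
        c / (L : ℝ) ^ (2 * (d + ñ) + 1) * (L : ℝ) ^ (2 * j) / (L : ℝ) ^ ((k - j) * (d - 1 + n)) ≤
            (fourierCoeff (𝒞f L N M 1 k) κ).re ∧
          ‖fourierCoeff (𝒞f L N M 1 k) κ‖ ≤
            max C 0 * (L : ℝ) ^ (2 * (d + ñ) + 1) * (L : ℝ) ^ (2 * j) / (L : ℝ) ^ ((k - j) * (d - 1 + n))) ∧
      (k ≤ j →
        c / (L : ℝ) ^ (2 * (d + ñ) + 1) * (L : ℝ) ^ (2 * k) ≤ (fourierCoeff (𝒞f L N M 1 k) κ).re ∧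
          ‖fourierCoeff (𝒞f L N M 1 k) κ‖ ≤ max C 0 * (L : ℝ) ^ (2 * k)) := by
    intro k hk1 hkN j κ hκ hj
    obtain ⟨h1, h2, -⟩ := hv k hk1 hkN j κ hκ hj
    refine ⟨fun hjk => ⟨(h1 hjk).1, (h1 hjk).2.trans ?_⟩, fun hkj => ⟨(h2 hkj).1, (h2 hkj).2.trans ?_⟩⟩
    · exact div_le_div_of_nonneg_right (mul_le_mul_of_nonneg_right
        (mul_le_mul_of_nonneg_right (le_max_left _ _) (by positivity)) (by positivity)) (by positivity)
    · exact mul_le_mul_of_nonneg_right (le_max_left _ _) (by positivity)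
  have hshell := fun κ hκ => exists_shell_and_bounds (d := d) (n := n) (ñ := ñ) hL5 hM hv' κ hκ
  have heven : ∀ k ∈ Icc 1 (N + 1), ∀ x, 𝒞f L N M 1 k (-x) = 𝒞f L N M 1 k x :=
    fun k hk => (ho' k hk).2
  have hinv := fun κ (hκ : κ ≠ 0) => sum_cExt_mul_symbR_eq_one Matrix.isSymm_one heven hii hκ
  have hf_even := fun κ j => cExt_fourierCoeff_neg (N := N) heven κ j
  have hf_zero := fun j => cExt_fourierCoeff_zero_mode (N := N) (fun k hk => (ho' k hk).1) j
  have hnn : ∀ (j : ℕ) (κ : Fin d → ZMod M),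
      0 ≤ cExt N (fun j => fourierCoeff (𝒞f L N M 1 j) κ) j := by
    intro j κ
    by_cases hκ : κ = 0
    · rw [hκ, hf_zero]
    · obtain ⟨j', -, -, hsb⟩ := hshell κ hκ
      exact cExt_nonneg hsb hc.le hLr0 j
  have hfr : ∀ j, 1 ≤ j → j ≤ N → ∃ c' : ℝ, ∀ x : Fin d → ZMod M,
      ((L : ℝ) ^ j) / 2 ≤ (supNorm x : ℝ) → 𝒞f L N M 1 j x = c' :=
    fun j hj1 hjN => ⟨Mc L N j, (hiii j hj1 hjN).2⟩
  have hreg : ∀ j, 1 ≤ j → j ≤ N + 1 → ∀ θ' : Fin d → ℕ, ∑ i, θ' i ≤ n → ∀ x,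
      |iterDiff θ' (𝒞f L N M 1 j) x| ≤ Cα θ' 0 / (L : ℝ) ^ ((j - 1) * (d - 2 + ∑ i, θ' i)) := by
    intro j hj1 hjN θ' hθ' x
    obtain ⟨-, hb⟩ := hiv j hj1 hjN 0 isUnitSymm_zero
    have := hb θ' hθ' 0 x
    rw [iteratedDeriv_zero] at this
    simpa only [smul_zero, add_zero] using this
  -- the schedule at this `N`
  obtain ⟨hθrec, hθlo, hθhi2, hθhi1, hδnn, hδ4, hμδ', hδN⟩ :=
    schedule_of_core (lam := lam) hθ0 (by linarith) hμ0 hδ₀.le hδ₁ hμδ hδlam N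
  have hθw : 0 < 1 + θbar := by linarith
  have hlarge' : ∀ k, shellConst s (L : ℝ) (k₀ + 1) * (d * π ^ 2) *
      ((1 + thetaSeq θbar μ δ₁ N k) * (1 * (4 / π ^ 2))⁻¹ + lam * (4 / π ^ 2)⁻¹) ^ 2 ≤
      μ * ((c / (L : ℝ) ^ (2 * (d + ñ) + 1)) / ((L : ℝ) ^ 2 * ((L : ℝ) ^ (d - 1 + n)) ^ (k₀ + 2))) :=
    fun k => hlarge _ (by linarith [hθlo k]) (hθhi2 k)
  have hseed0 : (1 / 2 + schedDelta δ₀ δ₁ N 0 * ∑ α ∈ s, ((4 : ℝ) * d) ^ (∑ i, α i - 1)) *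
      (1 + thetaSeq θbar μ δ₁ N 0 + lam) ≤ 1 := by
    rw [schedDelta_zero, thetaSeq_zero, ← hK]; exact hseed
  have hD := dominated_abkmWeightData (M := M) hR2 hL hd1 hMord (n := n) (ñ := ñ) (by omega) hc.le
    (le_max_right C 0) hshell hf_even hf_zero hinv hθw hlam hμ0 hθrec hθlo hθhi1 hδnn hδ4 hμδ' hδN
    hsmall hlarge' hseed0
  exact {
    eq := rfl
    dominated := hD
    theta_mem := fun k => ⟨hθlo k, hθhi2 k⟩
    monotone := monotone_abkmWeightData L N Mord R θbar hδnn _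
    isLocal := local_abkmWeightData N hMord1 hMR hLM h3L θbar _ _
    additive := additive_abkmWeightData (hMord1.trans hMR) hL hM hθw.le _
      (fun j hj1 hjN => heven j (mem_Icc.2 ⟨hj1, hjN⟩)) hnn hfr
    strong := fun s' hs' g hg => strongDominated_abkmWeightData L N R θbar hδnn _ hs' hg
    integral := fun k hk X hX φ =>
      integral_weight_abkm_le hd2 hMord1 hMR hLodd hL hθ0 hlam hθlo hnn hf_zero hf_even hD hk
        (heven (k + 1) (mem_Icc.2 ⟨by omega, hk⟩)) hn
        (Cα := fun θ' _ => Cα θ' 0) (fun θ' hθ' x => hreg (k + 1) (by omega) hk θ' hθ' x) hX φ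
    zero_sum_even := ho'
    pos := fun j hj φ hφ => by rw [mem_Icc] at hj; exact hi j hj.1 hj.2 φ hφ
    green := hii
    finiteRange := hfr
    regular := ⟨fun θ' => Cα θ' 0, hreg⟩
    multipliers_nonneg := hnn }

end Literature.MathematicalPhysics.StatisticalMechanics.GradientRG

end
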